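import Mathlib
import Literature.AlgebraicGeometry.Tropical.InitialIdeal

/-!
# TropicalLinks / InductiveStep — the unit-graph re-embedding presents the principal open

Route `ResolutionOfSingularities/TropicalLinks`, crux `InductiveStep` (stmt-ResolutionOfSingularities-17233),
line `split`, in support of stub `stub_sncClosureSchon` (and of every item of the route, all of which
inline the same re-embedding).

For a field `k`, an ideal `I ⊆ R := k[ℤ^N] = AddMonoidAlgebra k (Fin N → ℤ)` and Laurent polynomials
`G₁ … G_m ∈ R`, the route re-embeds the principal open `U[G⁻¹]` of `U = V(I) ⊆ 𝔾_m^N` into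
`𝔾_m^(N+m)` by the graph of the units `G_j`: with `ι : R → S := k[ℤ^(N+m)]` the lattice embedding
`x^v ↦ x^(v,0)` and `y_j := x^(0,e_j)`, the extended ideal is `I' := ⟨ι(I), y_j − ι(G_j)⟩ ⊆ S`.
This file proves, sorry-free and with the route's INLINED terms (no new definitions):

* `tropicalLinks_units_prod_zpow_eq_single` — in a group algebra `k[M]`, a product of integer powers
  of monomial units is the monomial of the corresponding `ℤ`-combination of exponents;
* `tropicalLinks_extIdeal_presentation` — **`S ⧸ I' ≃ₐ[k] (R ⧸ I)[(∏ G_j)⁻¹]`**, the isomorphism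
  sending the class of `ι f` to `f` and the class of `y_j` to `G_j` (so `Spec S/I'` IS the principal
  open `U[G⁻¹]`, as the route's docstrings assert informally); stated for any `x = ∏ mk(G_j)` so that
  the case `m = 1`, `x = mk g` applies verbatim to the `Localization.Away (Ideal.Quotient.mk I g)` of
  the split's stubs.

Consequence used by the line: at the weight `w = 0` (where `in_0(I') = I'`) the schön clause of
`SchonAt` says exactly that `U[G⁻¹]` is regular — file `TropicalLinksInductiveStepWeightZero.lean`.
-/

-- single-problem summit: the doubled namespace component `ResolutionOfSingularities` is forced
set_option linter.dupNamespace false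

namespace Summit.ResolutionOfSingularities.ResolutionOfSingularities.Theorems

open AddMonoidAlgebra

/-- **Monomials are products of powers of coordinate units.** In the group algebra `k[M]` of an
additive commutative group `M`, if `u i` is the unit with value the monomial `x^(e i)`, then for
integer exponents `z i` the unit `∏ i, (u i) ^ (z i)` has value the monomial `x^(∑ i, z i • e i)`.
[folklore] -/
theorem tropicalLinks_units_prod_zpow_eq_single {k : Type} [Field k] {M : Type} [AddCommGroup M]
    {ι : Type} [Fintype ι] (e : ι → M) (u : ι → (AddMonoidAlgebra k M)ˣ)
    (hu : ∀ i, (u i : AddMonoidAlgebra k M) = single (e i) 1) (z : ι → ℤ) :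
    ((∏ i, u i ^ z i : (AddMonoidAlgebra k M)ˣ) : AddMonoidAlgebra k M) = single (∑ i, z i • e i) 1 := by
  let MU : Multiplicative M →* (AddMonoidAlgebra k M)ˣ :=
    { toFun := fun v => ⟨single v.toAdd 1, single (-v.toAdd) 1,
        by rw [single_mul_single, add_neg_cancel, mul_one, one_def],
        by rw [single_mul_single, neg_add_cancel, mul_one, one_def]⟩
      map_one' := Units.ext (by simp [one_def])
      map_mul' := fun a b => Units.ext (by simp [single_mul_single]) }
  have hMU : ∀ i, u i = MU (Multiplicative.ofAdd (e i)) := fun i => Units.ext (by simp [MU, hu i])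
  calc ((∏ i, u i ^ z i : (AddMonoidAlgebra k M)ˣ) : AddMonoidAlgebra k M)
      = ((∏ i, MU (Multiplicative.ofAdd (e i)) ^ z i : (AddMonoidAlgebra k M)ˣ) :
          AddMonoidAlgebra k M) := by simp_rw [hMU]
    _ = ((MU (∏ i, Multiplicative.ofAdd (e i) ^ z i) : (AddMonoidAlgebra k M)ˣ) :
          AddMonoidAlgebra k M) := by
        rw [map_prod]; simp_rw [map_zpow]
    _ = ((MU (Multiplicative.ofAdd (∑ i, z i • e i)) : (AddMonoidAlgebra k M)ˣ) :
          AddMonoidAlgebra k M) := by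
        rw [ofAdd_sum]; simp_rw [ofAdd_zsmul]
    _ = single (∑ i, z i • e i) 1 := rfl

-- one declaration builds both directions of the isomorphism over a 2 kB inlined statement
-- (route terms, no auxiliary definitions allowed in Theorems/): ≈ 1.5× the default budget
set_option maxHeartbeats 400000 in
/-- **The unit-graph re-embedding presents the principal open.** For a field `k`, an ideal
`I ⊆ k[ℤ^N]`, Laurent polynomials `G : Fin m → k[ℤ^N]` and `x = ∏ j, mk I (G j)`, the quotient of
`k[ℤ^(N+m)]` by the route's extended ideal `I' = ⟨ι(I), y_j − ι(G_j)⟩` (written with the route's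
inlined `ι f = ofCoeff (f.coeff.mapDomain (v ↦ (v,0)))` and `y_j = single (0, e_j) 1`) is
`k`-isomorphic to the localization `(k[ℤ^N] ⧸ I)[x⁻¹]`, by an isomorphism sending the class of `ι f`
to (the image of) `f` and the class of `y_j` to (the image of) `G_j`. [folklore] -/
theorem tropicalLinks_extIdeal_presentation :
    ∀ (k : Type) [Field k] (N m : ℕ) (I : Ideal (AddMonoidAlgebra k (Fin N → ℤ))) (G : Fin m → AddMonoidAlgebra k (Fin N → ℤ)) (x : AddMonoidAlgebra k (Fin N → ℤ) ⧸ I), x = Ideal.Quotient.mk I (∏ j, G j) → ∃ e : (AddMonoidAlgebra k (Fin (N + m) → ℤ) ⧸ Ideal.span ((fun f : AddMonoidAlgebra k (Fin N → ℤ) => (AddMonoidAlgebra.ofCoeff (f.coeff.mapDomain fun v => Fin.append v (0 : Fin m → ℤ)) : AddMonoidAlgebra k (Fin (N + m) → ℤ))) '' (↑I : Set (AddMonoidAlgebra k (Fin N → ℤ))) ∪ Set.range (fun j : Fin m => AddMonoidAlgebra.single (Fin.append (0 : Fin N → ℤ) (Pi.single j (1 : ℤ))) (1 : k) - AddMonoidAlgebra.ofCoeff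 ((G j).coeff.mapDomain fun v => Fin.append v (0 : Fin m → ℤ))))) ≃ₐ[k] Localization.Away x, (∀ f : AddMonoidAlgebra k (Fin N → ℤ), e (Ideal.Quotient.mk (Ideal.span ((fun f : AddMonoidAlgebra k (Fin N → ℤ) => (AddMonoidAlgebra.ofCoeff (f.coeff.mapDomain fun v => Fin.append v (0 : Fin m → ℤ)) : AddMonoidAlgebra k (Fin (N + m) → ℤ))) '' (↑I : Set (AddMonoidAlgebra k (Fin N → ℤ))) ∪ Set.range (fun j : Fin m => AddMonoidAlgebra.single (Fin.append (0 : Fin N → ℤ) (Pi.single j (1 : ℤ))) (1 : k) - AddMonoidAlgebra.ofCoeff ((G j).coeff.mapDomain fun v => Fin.append v (0 : Fin m → ℤ))))) (AddMonoidAlgebra.ofCoeff (f.coeff.mapDomain fun v => Fin.append v (0 : Fin m → ℤ)))) = algebraMap (AddMonoidAlgebra k (Fin N → ℤ) ⧸ I) (Localization.Away x) (Ideal.Quotient.mk I f)) ∧ (∀ j : Fin m, e (Ideal.Quotient.mk (Ideal.span ((fun f : AddMonoidAlgebra k (Fin N → ℤ) => (AddMonoidAlgebra.ofCoeff (f.coeff.mapDomain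 fun v => Fin.append v (0 : Fin m → ℤ)) : AddMonoidAlgebra k (Fin (N + m) → ℤ))) '' (↑I : Set (AddMonoidAlgebra k (Fin N → ℤ))) ∪ Set.range (fun j : Fin m => AddMonoidAlgebra.single (Fin.append (0 : Fin N → ℤ) (Pi.single j (1 : ℤ))) (1 : k) - AddMonoidAlgebra.ofCoeff ((G j).coeff.mapDomain fun v => Fin.append v (0 : Fin m → ℤ))))) (AddMonoidAlgebra.single (Fin.append (0 : Fin N → ℤ) (Pi.single j (1 : ℤ))) (1 : k))) = algebraMap (AddMonoidAlgebra k (Fin N → ℤ) ⧸ I) (Localization.Away x) (Ideal.Quotient.mk I (G j))) := by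
  intro k _ N m I G x hx
  classical
  subst hx
  -- the lattice embedding `ι` as a `k`-algebra map, and its agreement with the route's inlined term
  let ιₐ : AddMonoidAlgebra k (Fin N → ℤ) →ₐ[k] AddMonoidAlgebra k (Fin (N + m) → ℤ) :=
    AddMonoidAlgebra.mapDomainAlgHom k k
      { toFun := fun v => Fin.append v (0 : Fin m → ℤ)
        map_zero' := by
          funext i
          exact Fin.addCases (fun i => by simp) (fun i => by simp) i
        map_add' := fun u v => by
          funext i
          exact Fin.addCases (fun i => by simp) (fun i => by simp) i }
  have hι : ∀ f : AddMonoidAlgebra k (Fin N → ℤ), ιₐ f =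
      AddMonoidAlgebra.ofCoeff (f.coeff.mapDomain fun v => Fin.append v (0 : Fin m → ℤ)) := fun f => rfl
  have hι_single : ∀ v : Fin N → ℤ, ιₐ (single v 1) = single (Fin.append v (0 : Fin m → ℤ)) 1 := by
    intro v
    rw [AddMonoidAlgebra.mapDomainAlgHom_apply, AddMonoidAlgebra.mapDomain_single]
    rfl
  clear_value ιₐ
  -- names; the generating set `T` of `I'` is made opaque (only `hT` knows its definition)
  generalize hT : ((fun f : AddMonoidAlgebra k (Fin N → ℤ) => (AddMonoidAlgebra.ofCoeff (f.coeff.mapDomain fun v => Fin.append v (0 : Fin m → ℤ)) : AddMonoidAlgebra k (Fin (N + m) → ℤ))) '' (↑I : Set (AddMonoidAlgebra k (Fin N → ℤ))) ∪ Set.range (fun j : Fin m => AddMonoidAlgebra.single (Fin.append (0 : Fin N → ℤ) (Pi.single j (1 : ℤ))) (1 : k) - AddMonoidAlgebra.ofCoeff ((G j).coeff.mapDomain fun v => Fin.append v (0 : Fin m → ℤ)))) = T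
  set A := AddMonoidAlgebra k (Fin N → ℤ) ⧸ I with hA
  set L := Localization.Away (Ideal.Quotient.mk I (∏ j, G j)) with hL
  -- the `G_j` are units of `L`
  have hGunit : ∀ j, IsUnit (algebraMap A L (Ideal.Quotient.mk I (G j))) := by
    intro j
    exact isUnit_of_dvd_unit
      (map_dvd (algebraMap A L) (map_dvd (Ideal.Quotient.mk I)
        (Finset.dvd_prod_of_mem G (Finset.mem_univ j))))
      (IsLocalization.Away.algebraMap_isUnit (S := L) (Ideal.Quotient.mk I (∏ j, G j)))
  let uG : Fin m → Lˣ := fun j => (hGunit j).unit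
  have huG : ∀ j, (uG j : L) = algebraMap A L (Ideal.Quotient.mk I (G j)) := fun j => (hGunit j).unit_spec
  clear_value uG
  -- the forward map on monomials: `x^(a,z) ↦ x^a · ∏ G_j^(z_j)`
  let Θ : Multiplicative (Fin (N + m) → ℤ) →* L :=
    { toFun := fun v => algebraMap A L (Ideal.Quotient.mk I
          (single (fun i : Fin N => Multiplicative.toAdd v (Fin.castAdd m i)) (1 : k))) *
        ((∏ j, uG j ^ (Multiplicative.toAdd v (Fin.natAdd N j)) : Lˣ) : L)
      map_one' := by
        simp only [toAdd_one, Pi.zero_apply, zpow_zero, Finset.prod_const_one, Units.val_one, mul_one]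
        rw [show (fun _ : Fin N => (0 : ℤ)) = (0 : Fin N → ℤ) from rfl, ← one_def, map_one, map_one]
      map_mul' := fun a b => by
        simp only [toAdd_mul, Pi.add_apply, zpow_add, Finset.prod_mul_distrib, Units.val_mul]
        rw [show single (fun i : Fin N => Multiplicative.toAdd a (Fin.castAdd m i) +
              Multiplicative.toAdd b (Fin.castAdd m i)) (1 : k) =
            single (fun i : Fin N => Multiplicative.toAdd a (Fin.castAdd m i)) 1 *
              single (fun i : Fin N => Multiplicative.toAdd b (Fin.castAdd m i)) 1 by
            rw [single_mul_single, mul_one]; rfl, map_mul, map_mul]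
        ring }
  have hΘ : ∀ v : Fin (N + m) → ℤ, Θ (Multiplicative.ofAdd v) =
      algebraMap A L (Ideal.Quotient.mk I (single (fun i : Fin N => v (Fin.castAdd m i)) (1 : k))) *
        ((∏ j, uG j ^ (v (Fin.natAdd N j)) : Lˣ) : L) := fun v => rfl
  clear_value Θ
  let φ : AddMonoidAlgebra k (Fin (N + m) → ℤ) →ₐ[k] L := AddMonoidAlgebra.lift k L (Fin (N + m) → ℤ) Θ
  have hφ_single : ∀ v : Fin (N + m) → ℤ, φ (single v 1) =
      algebraMap A L (Ideal.Quotient.mk I (single (fun i : Fin N => v (Fin.castAdd m i)) (1 : k))) *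
        ((∏ j, uG j ^ (v (Fin.natAdd N j)) : Lˣ) : L) := by
    intro v
    rw [AddMonoidAlgebra.lift_single, one_smul, hΘ]
  clear_value φ
  have hφι_single : ∀ v : Fin N → ℤ, φ (ιₐ (single v 1)) =
      algebraMap A L (Ideal.Quotient.mk I (single v 1)) := by
    intro v
    rw [hι_single, hφ_single]
    simp only [Fin.append_left, Fin.append_right, Pi.zero_apply, zpow_zero, Finset.prod_const_one,
      Units.val_one, mul_one]
  have hφι : ∀ f : AddMonoidAlgebra k (Fin N → ℤ), φ (ιₐ f) = algebraMap A L (Ideal.Quotient.mk I f) := by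
    have key : φ.comp ιₐ = (IsScalarTower.toAlgHom k A L).comp (Ideal.Quotient.mkₐ k I) :=
      AddMonoidAlgebra.algHom_ext (fun v => by
        rw [AlgHom.comp_apply, AlgHom.comp_apply, IsScalarTower.coe_toAlgHom', Ideal.Quotient.mkₐ_eq_mk]
        exact hφι_single v) (by apply Algebra.ext_id)
    intro f
    exact congr($key f)
  have hpow_single : ∀ j j' : Fin m,
      uG j' ^ ((Pi.single j (1 : ℤ) : Fin m → ℤ) j') = if j' = j then uG j else 1 := by
    intro j j'
    by_cases h : j' = j
    · subst h; simp
    · simp [h]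
  have hφy : ∀ j : Fin m, φ (single (Fin.append (0 : Fin N → ℤ) (Pi.single j (1 : ℤ))) 1) = (uG j : L) := by
    intro j
    rw [hφ_single]
    simp only [Fin.append_left, Fin.append_right, Pi.zero_apply, hpow_single, Finset.prod_ite_eq',
      Finset.mem_univ, if_true]
    rw [show (fun _ : Fin N => (0 : ℤ)) = (0 : Fin N → ℤ) from rfl, ← one_def, map_one, map_one, one_mul]
  -- `I'` is killed by `φ`
  have hT0 : ∀ a ∈ Ideal.span T, φ a = 0 := by
    intro a ha
    refine (Ideal.span_le (I := RingHom.ker φ.toRingHom)).2 ?_ ha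
    intro b hb
    rw [← hT] at hb
    rcases hb with ⟨f, hf, rfl⟩ | ⟨j, rfl⟩
    · have h0 : φ (ιₐ f) = 0 := by rw [hφι, Ideal.Quotient.eq_zero_iff_mem.2 hf, map_zero]
      rw [hι] at h0
      exact h0
    · have h0 : φ (single (Fin.append (0 : Fin N → ℤ) (Pi.single j (1 : ℤ))) 1 - ιₐ (G j)) = 0 := by
        rw [map_sub, hφy, hφι, huG, sub_self]
      rw [hι] at h0
      exact h0
  let ψ : (AddMonoidAlgebra k (Fin (N + m) → ℤ) ⧸ Ideal.span T) →ₐ[k] L :=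
    Ideal.Quotient.liftₐ (Ideal.span T) φ hT0
  have hψ : ∀ a, ψ (Ideal.Quotient.mk (Ideal.span T) a) = φ a := fun a => rfl
  clear_value ψ
  -- the inverse map
  have hIT : ∀ f ∈ I, ((Ideal.Quotient.mkₐ k (Ideal.span T)).comp ιₐ) f = 0 := fun f hf =>
    Ideal.Quotient.eq_zero_iff_mem.2 (Ideal.subset_span (by rw [← hT]; exact Or.inl ⟨f, hf, (hι f).symm⟩))
  let χ₀ : A →ₐ[k] AddMonoidAlgebra k (Fin (N + m) → ℤ) ⧸ Ideal.span T :=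
    Ideal.Quotient.liftₐ I ((Ideal.Quotient.mkₐ k (Ideal.span T)).comp ιₐ) hIT
  have hχ₀ : ∀ f, χ₀ (Ideal.Quotient.mk I f) = Ideal.Quotient.mk (Ideal.span T) (ιₐ f) := fun f => rfl
  clear_value χ₀
  have hyT : ∀ j, Ideal.Quotient.mk (Ideal.span T) (ιₐ (G j)) =
      Ideal.Quotient.mk (Ideal.span T) (single (Fin.append (0 : Fin N → ℤ) (Pi.single j (1 : ℤ))) 1) := by
    intro j
    rw [eq_comm, Ideal.Quotient.eq, hι]
    exact Ideal.subset_span (by rw [← hT]; exact Or.inr ⟨j, rfl⟩)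
  have hySunit : ∀ j : Fin m, IsUnit (single (Fin.append (0 : Fin N → ℤ) (Pi.single j (1 : ℤ))) (1 : k) :
      AddMonoidAlgebra k (Fin (N + m) → ℤ)) := fun j =>
    Literature.AlgebraicGeometry.Tropical.isUnit_single isUnit_one _
  have hunit : ∀ y : Submonoid.powers (Ideal.Quotient.mk I (∏ j, G j)), IsUnit (χ₀ y) := by
    rintro ⟨y, n, rfl⟩
    rw [map_pow]
    refine IsUnit.pow _ ?_
    rw [map_prod, map_prod, IsUnit.prod_univ_iff]
    intro j
    rw [hχ₀, hyT]
    exact (hySunit j).map _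
  let χ : L →ₐ[k] AddMonoidAlgebra k (Fin (N + m) → ℤ) ⧸ Ideal.span T :=
    IsLocalization.liftAlgHom (M := Submonoid.powers (Ideal.Quotient.mk I (∏ j, G j))) (f := χ₀) hunit
  have hχ : ∀ a : A, χ (algebraMap A L a) = χ₀ a := fun a => by
    rw [IsLocalization.liftAlgHom_apply, IsLocalization.lift_eq]
    rfl
  clear_value χ
  -- `ψ ∘ χ = id`
  have h1 : ψ.comp χ = AlgHom.id k L := by
    apply IsLocalization.algHom_ext (Submonoid.powers (Ideal.Quotient.mk I (∏ j, G j)))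
    apply Ideal.Quotient.algHom_ext k
    refine AddMonoidAlgebra.algHom_ext (fun v => ?_) (by apply Algebra.ext_id)
    change ψ (χ (algebraMap A L (Ideal.Quotient.mk I (single v 1)))) =
      algebraMap A L (Ideal.Quotient.mk I (single v 1))
    rw [hχ, hχ₀, hψ, hφι]
  -- `χ ∘ ψ = id`
  have happend : ∀ v : Fin (N + m) → ℤ,
      Fin.append (fun i : Fin N => v (Fin.castAdd m i)) (0 : Fin m → ℤ) +
        Fin.append (0 : Fin N → ℤ) (fun j : Fin m => v (Fin.natAdd N j)) = v := by
    intro v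
    funext i
    refine Fin.addCases (fun i => ?_) (fun i => ?_) i <;> simp
  have hsum : ∀ z : Fin m → ℤ,
      ∑ j, z j • Fin.append (0 : Fin N → ℤ) (Pi.single j (1 : ℤ)) = Fin.append (0 : Fin N → ℤ) z := by
    intro z
    funext i
    refine Fin.addCases (fun i => ?_) (fun i => ?_) i
    · simp
    · simp [Pi.single_apply]
  have hχunits : ∀ j : Fin m, Units.map (χ : L →* AddMonoidAlgebra k (Fin (N + m) → ℤ) ⧸ Ideal.span T) (uG j) =
      Units.map (Ideal.Quotient.mk (Ideal.span T) : AddMonoidAlgebra k (Fin (N + m) → ℤ) →*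
        AddMonoidAlgebra k (Fin (N + m) → ℤ) ⧸ Ideal.span T) (hySunit j).unit := by
    intro j
    ext
    rw [Units.coe_map, Units.coe_map, MonoidHom.coe_coe, MonoidHom.coe_coe, huG,
      (hySunit j).unit_spec, hχ, hχ₀, hyT]
  have hχprod : ∀ z : Fin m → ℤ, χ ((∏ j, uG j ^ z j : Lˣ) : L) =
      Ideal.Quotient.mk (Ideal.span T) (single (Fin.append (0 : Fin N → ℤ) z) 1) := by
    intro z
    calc χ ((∏ j, uG j ^ z j : Lˣ) : L)
        = ((Units.map (χ : L →* AddMonoidAlgebra k (Fin (N + m) → ℤ) ⧸ Ideal.span T)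
            (∏ j, uG j ^ z j) : (AddMonoidAlgebra k (Fin (N + m) → ℤ) ⧸ Ideal.span T)ˣ) :
            AddMonoidAlgebra k (Fin (N + m) → ℤ) ⧸ Ideal.span T) := (Units.coe_map _ _).symm
      _ = ((∏ j, (Units.map (χ : L →* AddMonoidAlgebra k (Fin (N + m) → ℤ) ⧸ Ideal.span T) (uG j)) ^ z j :
            (AddMonoidAlgebra k (Fin (N + m) → ℤ) ⧸ Ideal.span T)ˣ) :
            AddMonoidAlgebra k (Fin (N + m) → ℤ) ⧸ Ideal.span T) := by
          rw [map_prod]; simp_rw [map_zpow]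
      _ = ((∏ j, (Units.map (Ideal.Quotient.mk (Ideal.span T) : AddMonoidAlgebra k (Fin (N + m) → ℤ) →*
              AddMonoidAlgebra k (Fin (N + m) → ℤ) ⧸ Ideal.span T) (hySunit j).unit) ^ z j :
            (AddMonoidAlgebra k (Fin (N + m) → ℤ) ⧸ Ideal.span T)ˣ) :
            AddMonoidAlgebra k (Fin (N + m) → ℤ) ⧸ Ideal.span T) := by simp_rw [hχunits]
      _ = ((Units.map (Ideal.Quotient.mk (Ideal.span T) : AddMonoidAlgebra k (Fin (N + m) → ℤ) →*
              AddMonoidAlgebra k (Fin (N + m) → ℤ) ⧸ Ideal.span T) (∏ j, (hySunit j).unit ^ z j) :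
            (AddMonoidAlgebra k (Fin (N + m) → ℤ) ⧸ Ideal.span T)ˣ) :
            AddMonoidAlgebra k (Fin (N + m) → ℤ) ⧸ Ideal.span T) := by
          rw [map_prod]; simp_rw [map_zpow]
      _ = Ideal.Quotient.mk (Ideal.span T) ((∏ j, (hySunit j).unit ^ z j :
            (AddMonoidAlgebra k (Fin (N + m) → ℤ))ˣ) : AddMonoidAlgebra k (Fin (N + m) → ℤ)) := Units.coe_map _ _
      _ = Ideal.Quotient.mk (Ideal.span T) (single (Fin.append (0 : Fin N → ℤ) z) 1) := by
          rw [tropicalLinks_units_prod_zpow_eq_single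
            (fun j : Fin m => Fin.append (0 : Fin N → ℤ) (Pi.single j (1 : ℤ)))
            (fun j => (hySunit j).unit) (fun j => (hySunit j).unit_spec), hsum]
  have h2 : χ.comp ψ = AlgHom.id k _ := by
    apply Ideal.Quotient.algHom_ext k
    refine AddMonoidAlgebra.algHom_ext (fun v => ?_) (by apply Algebra.ext_id)
    rw [AlgHom.comp_apply, AlgHom.comp_apply, AlgHom.comp_apply, AlgHom.id_apply, Ideal.Quotient.mkₐ_eq_mk,
      hψ]
    have e1 := congrArg χ (hφ_single v)
    rw [e1]
    rw [map_mul]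
    rw [hχ]
    rw [hχ₀]
    rw [hι_single]
    rw [hχprod]
    rw [← map_mul (Ideal.Quotient.mk (Ideal.span T))]
    rw [single_mul_single, mul_one, happend]
  have happly : ∀ a, AlgEquiv.ofAlgHom ψ χ h1 h2 a = ψ a := fun a => rfl
  refine ⟨AlgEquiv.ofAlgHom ψ χ h1 h2, fun f => ?_, fun j => ?_⟩
  · rw [happly, ← hι, hψ, hφι]
  · rw [happly, hψ, hφy, huG]

end Summit.ResolutionOfSingularities.ResolutionOfSingularities.Theorems
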